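import Literature.Computability.MetaComplexity.NWLexicodeDesigns
import HarnessLib

/-!
# Weak designs (Raz–Reingold–Vadhan) by the method of conditional expectations

Topic `Literature/Computability/MetaComplexity`, third instalment of the design layer of
`NWGenerator.lean` / `NWLexicodeDesigns.lean`. Trevisan's extractor and Hirahara's non-black-box
reduction (FOCS 2018 / ECCC TR18-138, §4.1) use the Nisan–Wigderson generator with the WEAK designs
of Raz, Reingold and Vadhan: what the reconstruction pays for is not `max_{j≠i} |Sᵢ ∩ Sⱼ|` but the
total table size `∑_{j<i} 2^{|Sᵢ ∩ Sⱼ|}`, and this can be made `≈ (1 + o(1))·m` for `m` blocks of size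
`ℓ` in a universe of size `d = ℓ·b` only slightly larger than `ℓ²`:

> Hirahara 2018, Lemma 4.4 (from [RRV02, Lemma 15]). *For `m, ℓ, d ∈ ℕ` with `d/ℓ ∈ ℕ` there is a
> family `S₁, …, S_m ⊆ [d]` of `ℓ`-sets with `∑_{j<i} 2^{|Sᵢ∩Sⱼ|} ≤ (1 + ℓ/d)^ℓ · (i − 1) ≤ exp(ℓ²/d)·i`
> for every `i`, constructible deterministically in time `poly(m, d)`.* "(The family is constructed
> by dividing `[d]` into `ℓ` disjoint blocks of size `d/ℓ`, and, for each `i ∈ [m]`, choosing one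
> random element out of each block and adding it to `Sᵢ`. The construction can be derandomized by
> the method of conditional expectations.)"

This file carries out exactly that derandomisation, PROVED, in the representation of
`NWLexicodeDesigns.lean` (universe `[ℓ] × [b]`, a block = the graph of a word `g : [ℓ] → [b]`, so that
`|block g ∩ block g'| = agree g g'`, `card_graphBlock_inter`):

* `WeakDesign.agreeP p g` — agreements of a PREFIX `p : List [b]` with a word `g`; `WeakDesign.phi` —
  the potential `Φ(p) = ∑_{g ∈ prev} 2^{agreeP p g}` (the conditional expectation of
  `∑_j 2^{|S ∩ Sⱼ|}` up to the factor `((b+1)/b)^{ℓ-|p|}`); `sum_phi_append` — **averaging over the next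
  symbol multiplies the potential by exactly `(b+1)`** (`∑_c Φ(p·c) = (b+1)·Φ(p)`);
* `WeakDesign.greedyNext` — the first symbol minimising `Φ(p·c)` (a left fold, the shape a string
  machine recomputes), `phi_greedyNext_le` (`b·Φ(p·c*) ≤ (b+1)·Φ(p)`); `greedyPrefix`, `greedyWord` and
  the invariant `pow_mul_phi_greedyPrefix_le` (`bᵏ·Φ(pₖ) ≤ (b+1)ᵏ·|prev|`);
* `WeakDesign.wdList b ℓ m` — **the weak design**: `m` words, each greedy against its predecessors;
  `wdList_prefix`, `length_wdList`, `getElem_wdList`;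
* `WeakDesign.quality_wdList` — **`b^ℓ · ∑_{j<i} 2^{agree wᵢ wⱼ} ≤ (b+1)^ℓ · i`** (Lemma 4.4 / RRV Lemma 15
  with `(1 + ℓ/d)^ℓ = ((b+1)/b)^ℓ`, `d = ℓ b`);
* `WeakDesign.pow_succ_mul_le` — the elementary estimate `(b+1)^ℓ · b ≤ b^ℓ · (b + 2ℓ)` for `2ℓ ≤ b`
  (i.e. `(1 + 1/b)^ℓ ≤ 1 + 2ℓ/b`, the form of "`exp(ℓ²/d) ≤ 1 + 2ℓ²/d` since `ℓ²/d ≤ 1`" used in the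
  proof of Cor. 4.12).

No machines here; the polynomial-time recomputation of `wdList` is a separate (string) layer.

## References

* R. Raz, O. Reingold, S. Vadhan, *Extracting all the randomness and reducing the error in
  Trevisan's extractors*, JCSS 65 (2002) 97–128, Def. 6 (weak designs), Lemma 15, Lemma 17.
* S. Hirahara, *Non-black-box worst-case to average-case reductions within NP*, FOCS 2018; full
  version ECCC TR18-138 (rev. 1), Def. 4.3, Lemma 4.4 (p. 15), proof of Cor. 4.12 (p. 19).
* L. Trevisan, *Extractors and pseudorandom generators*, J. ACM 48 (2001) 860–879, §2.
-/

namespace Literature.Computability.MetaComplexity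

open Finset

namespace WeakDesign

variable {ℓ b : ℕ}

/-! ### Prefix agreements and the potential -/

/-- Agreements of a prefix `p` (symbols chosen for the first `|p|` coordinates) with a word `g`:
`#{r < ℓ | p_r = g r}`. [cite: RazReingoldVadhan2002, Lemma 15 (proof)] -/
def agreeP (p : List (Fin b)) (g : Fin ℓ → Fin b) : ℕ := #{r : Fin ℓ | p[(r : ℕ)]? = some (g r)}

/-- The empty prefix agrees nowhere. [folklore] -/
@[simp] theorem agreeP_nil (g : Fin ℓ → Fin b) : agreeP ([] : List (Fin b)) g = 0 := by
  simp [agreeP]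

/-- `agreeP` as a sum of indicators. [folklore] -/
theorem agreeP_eq_sum (p : List (Fin b)) (g : Fin ℓ → Fin b) :
    agreeP p g = ∑ r : Fin ℓ, if p[(r : ℕ)]? = some (g r) then 1 else 0 := by
  unfold agreeP
  rw [Finset.card_filter]

/-- Appending a symbol adds one agreement iff it hits `g` at the new coordinate. [folklore] -/
theorem agreeP_append_singleton (p : List (Fin b)) (c : Fin b) (g : Fin ℓ → Fin b) (hp : p.length < ℓ) :
    agreeP (p ++ [c]) g = agreeP p g + if g ⟨p.length, hp⟩ = c then 1 else 0 := by
  classical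
  rw [agreeP_eq_sum, agreeP_eq_sum]
  set r₀ : Fin ℓ := ⟨p.length, hp⟩ with hr₀
  have key : ∀ r : Fin ℓ, (if (p ++ [c])[(r : ℕ)]? = some (g r) then 1 else 0 : ℕ) =
      (if p[(r : ℕ)]? = some (g r) then 1 else 0) + if r = r₀ then (if g r₀ = c then 1 else 0) else 0 := by
    intro r
    rcases lt_trichotomy (r : ℕ) p.length with h | h | h
    · have hne : r ≠ r₀ := fun hh => by rw [hh, hr₀] at h; exact lt_irrefl _ h
      rw [List.getElem?_append_left h, if_neg hne, add_zero]
    · have hr : r = r₀ := Fin.ext h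
      rw [hr]
      have h1 : (p ++ [c])[(r₀ : ℕ)]? = some c := by
        show (p ++ [c])[p.length]? = some c
        rw [List.getElem?_append_right le_rfl, Nat.sub_self, List.getElem?_cons_zero]
      have h2 : p[(r₀ : ℕ)]? = none := by
        show p[p.length]? = none
        exact List.getElem?_eq_none le_rfl
      rw [h1, h2, if_pos rfl]
      by_cases hc : g r₀ = c
      · rw [if_pos (by rw [hc]), if_pos hc]; simp
      · rw [if_neg (fun h' => hc (Option.some_injective _ h').symm), if_neg hc]; simp
    · have hne : r ≠ r₀ := fun hh => by rw [hh, hr₀] at h; exact lt_irrefl _ h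
      have h1 : (p ++ [c])[(r : ℕ)]? = none := List.getElem?_eq_none (by simp; omega)
      have h2 : p[(r : ℕ)]? = none := List.getElem?_eq_none h.le
      rw [h1, h2, if_neg hne]
      simp
  simp_rw [key]
  rw [sum_add_distrib, sum_ite_eq' univ r₀, if_pos (mem_univ _)]

/-- A full-length prefix agrees with `g` exactly where the word it spells does:
`agreeP p g = agree (p as a word) g`. [folklore] -/
theorem agreeP_eq_agree (p : List (Fin b)) (hp : p.length = ℓ) (g : Fin ℓ → Fin b) :
    agreeP p g = agree (fun r : Fin ℓ => p[(r : ℕ)]'(hp ▸ r.isLt)) g := by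
  unfold agreeP agree
  congr 1
  ext r
  simp only [mem_filter, mem_univ, true_and]
  rw [List.getElem?_eq_getElem (hp ▸ r.isLt)]
  exact Option.some_inj

/-- **The potential** `Φ(p) = ∑_{g ∈ prev} 2^{agreeP p g}`: up to the factor `((b+1)/b)^{ℓ - |p|}`, the
conditional expectation of `∑_j 2^{|S ∩ Sⱼ|}` given the first `|p|` choices.
[cite: RazReingoldVadhan2002, Lemma 15 (proof, conditional expectations)] -/
def phi (prev : List (Fin ℓ → Fin b)) (p : List (Fin b)) : ℕ := (prev.map fun g => 2 ^ agreeP p g).sum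

/-- `Φ(∅-prefix) = |prev|`. [folklore] -/
@[simp] theorem phi_nil (prev : List (Fin ℓ → Fin b)) : phi prev [] = prev.length := by
  induction prev with
  | nil => simp [phi]
  | cons g prev ih =>
    simp only [phi, List.map_cons, List.sum_cons, agreeP_nil, pow_zero, List.length_cons] at ih ⊢
    omega

/-- `Φ` is additive in `prev`. [folklore] -/
theorem phi_append (prev prev' : List (Fin ℓ → Fin b)) (p : List (Fin b)) :
    phi (prev ++ prev') p = phi prev p + phi prev' p := by
  simp [phi, List.sum_append]

/-- At full length the potential is the table size `∑_{g ∈ prev} 2^{agree w g}` of the word spelled.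
[cite: Hirahara2018, Def. 4.3] -/
theorem phi_eq_sum_agree (prev : List (Fin ℓ → Fin b)) (p : List (Fin b)) (hp : p.length = ℓ) :
    phi prev p = (prev.map fun g => 2 ^ agree (fun r : Fin ℓ => p[(r : ℕ)]'(hp ▸ r.isLt)) g).sum := by
  unfold phi
  congr 1
  refine List.map_congr_left fun g _ => ?_
  rw [agreeP_eq_agree p hp]

/-- For one word: `∑_c 2^{agreeP (p·c) g} = (b+1) · 2^{agreeP p g}` (exactly one symbol `c` hits `g`
at the new coordinate and doubles the term, the other `b - 1` leave it). [cite: RazReingoldVadhan2002, Lemma 15 (proof)] -/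
theorem sum_pow_agreeP_append (p : List (Fin b)) (g : Fin ℓ → Fin b) (hp : p.length < ℓ) :
    ∑ c : Fin b, 2 ^ agreeP (p ++ [c]) g = (b + 1) * 2 ^ agreeP p g := by
  classical
  simp_rw [agreeP_append_singleton p _ g hp, pow_add]
  rw [← mul_sum]
  have : ∑ c : Fin b, (2 : ℕ) ^ (if g ⟨p.length, hp⟩ = c then 1 else 0) = b + 1 := by
    have h : ∀ c : Fin b, (2 : ℕ) ^ (if g ⟨p.length, hp⟩ = c then 1 else 0) =
        1 + if g ⟨p.length, hp⟩ = c then 1 else 0 := fun c => by split_ifs <;> simp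
    simp_rw [h]
    rw [sum_add_distrib, sum_const, card_univ, Fintype.card_fin, smul_eq_mul, mul_one, sum_ite_eq]
    simp
  rw [this, mul_comm]

/-- **Averaging step**: `∑_c Φ(p·c) = (b+1)·Φ(p)`. [cite: RazReingoldVadhan2002, Lemma 15 (proof)] -/
theorem sum_phi_append (prev : List (Fin ℓ → Fin b)) (p : List (Fin b)) (hp : p.length < ℓ) :
    ∑ c : Fin b, phi prev (p ++ [c]) = (b + 1) * phi prev p := by
  induction prev with
  | nil => simp [phi]
  | cons g prev ih =>
    have h1 : ∀ q : List (Fin b), phi (g :: prev) q = 2 ^ agreeP q g + phi prev q := fun q => by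
      simp [phi]
    simp_rw [h1]
    rw [sum_add_distrib, ih, sum_pow_agreeP_append p g hp, mul_add]

/-! ### The greedy symbol, prefix and word -/

/-- The fold step of the scan for the first minimiser: replace the current best only on a STRICT
improvement. [folklore] -/
def scanStep (F : Fin b → ℕ) (best c : Fin b) : Fin b := if F c < F best then c else best

/-- **The greedy symbol**: the first `c ∈ [b]` minimising `F` (a left-to-right scan started at `c₀`).
[cite: Hirahara2018, Lemma 4.4 (proof, derandomisation)] -/
def scanMin (F : Fin b → ℕ) (c₀ : Fin b) (cs : List (Fin b)) : Fin b := cs.foldl (scanStep F) c₀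

/-- The scan never increases the value. [folklore] -/
theorem apply_scanMin_le_init (F : Fin b → ℕ) (c₀ : Fin b) (cs : List (Fin b)) : F (scanMin F c₀ cs) ≤ F c₀ := by
  induction cs generalizing c₀ with
  | nil => exact le_rfl
  | cons c cs ih =>
    simp only [scanMin, List.foldl_cons]
    refine (ih _).trans ?_
    unfold scanStep
    split_ifs with h
    · exact h.le
    · exact le_rfl

/-- The scan result minimises `F` over the scanned symbols. [folklore] -/
theorem apply_scanMin_le (F : Fin b → ℕ) (c₀ : Fin b) (cs : List (Fin b)) {c : Fin b} (hc : c ∈ cs) :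
    F (scanMin F c₀ cs) ≤ F c := by
  induction cs generalizing c₀ with
  | nil => exact absurd hc List.not_mem_nil
  | cons c' cs ih =>
    simp only [scanMin, List.foldl_cons]
    rcases List.mem_cons.1 hc with rfl | hc
    · refine (apply_scanMin_le_init F _ cs).trans ?_
      unfold scanStep
      split_ifs with h
      · exact le_rfl
      · exact not_lt.1 h
    · exact ih _ hc

/-- **The greedy next symbol** for prefix `p` against `prev` (requires `b ≥ 1`): the first minimiser of
`c ↦ Φ(p·c)`. [cite: Hirahara2018, Lemma 4.4 (proof)] -/
def greedyNext (hb : 0 < b) (prev : List (Fin ℓ → Fin b)) (p : List (Fin b)) : Fin b :=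
  scanMin (fun c => phi prev (p ++ [c])) ⟨0, hb⟩ (List.finRange b)

/-- The greedy symbol minimises the potential. [cite: RazReingoldVadhan2002, Lemma 15 (proof)] -/
theorem phi_greedyNext_le_apply (hb : 0 < b) (prev : List (Fin ℓ → Fin b)) (p : List (Fin b)) (c : Fin b) :
    phi prev (p ++ [greedyNext hb prev p]) ≤ phi prev (p ++ [c]) :=
  apply_scanMin_le (fun c => phi prev (p ++ [c])) ⟨0, hb⟩ (List.finRange b) (List.mem_finRange c)

/-- **Minimum ≤ average**: `b · Φ(p·c*) ≤ (b+1) · Φ(p)`. [cite: RazReingoldVadhan2002, Lemma 15 (proof)] -/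
theorem mul_phi_greedyNext_le (hb : 0 < b) (prev : List (Fin ℓ → Fin b)) (p : List (Fin b)) (hp : p.length < ℓ) :
    b * phi prev (p ++ [greedyNext hb prev p]) ≤ (b + 1) * phi prev p := by
  rw [← sum_phi_append prev p hp]
  calc b * phi prev (p ++ [greedyNext hb prev p])
      = ∑ _c : Fin b, phi prev (p ++ [greedyNext hb prev p]) := by
        rw [sum_const, card_univ, Fintype.card_fin, smul_eq_mul]
    _ ≤ ∑ c : Fin b, phi prev (p ++ [c]) := sum_le_sum fun c _ => phi_greedyNext_le_apply hb prev p c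

/-- **The greedy prefix** of length `k`. [cite: Hirahara2018, Lemma 4.4 (proof)] -/
def greedyPrefix (hb : 0 < b) (prev : List (Fin ℓ → Fin b)) : ℕ → List (Fin b)
  | 0 => []
  | k + 1 => greedyPrefix hb prev k ++ [greedyNext hb prev (greedyPrefix hb prev k)]

/-- The greedy prefix of length `k` has length `k`. [folklore] -/
@[simp] theorem length_greedyPrefix (hb : 0 < b) (prev : List (Fin ℓ → Fin b)) (k : ℕ) :
    (greedyPrefix hb prev k).length = k := by
  induction k with
  | zero => rfl
  | succ k ih => simp [greedyPrefix, ih]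

/-- **The conditional-expectation invariant**: `bᵏ · Φ(pₖ) ≤ (b+1)ᵏ · |prev|` for `k ≤ ℓ`.
[cite: RazReingoldVadhan2002, Lemma 15 (proof)] -/
theorem pow_mul_phi_greedyPrefix_le (hb : 0 < b) (prev : List (Fin ℓ → Fin b)) {k : ℕ} (hk : k ≤ ℓ) :
    b ^ k * phi prev (greedyPrefix hb prev k) ≤ (b + 1) ^ k * prev.length := by
  induction k with
  | zero => simp [greedyPrefix]
  | succ k ih =>
    have hk' : k < ℓ := hk
    have hlen : (greedyPrefix hb prev k).length < ℓ := by rw [length_greedyPrefix]; exact hk'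
    calc b ^ (k + 1) * phi prev (greedyPrefix hb prev (k + 1))
        = b ^ k * (b * phi prev (greedyPrefix hb prev k ++ [greedyNext hb prev (greedyPrefix hb prev k)])) := by
          rw [pow_succ, greedyPrefix]; ring
      _ ≤ b ^ k * ((b + 1) * phi prev (greedyPrefix hb prev k)) :=
          Nat.mul_le_mul_left _ (mul_phi_greedyNext_le hb prev _ hlen)
      _ = (b + 1) * (b ^ k * phi prev (greedyPrefix hb prev k)) := by ring
      _ ≤ (b + 1) * ((b + 1) ^ k * prev.length) := Nat.mul_le_mul_left _ (ih hk'.le)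
      _ = (b + 1) ^ (k + 1) * prev.length := by ring

/-- **The greedy word** against `prev`: the greedy prefix of full length, read as a word.
[cite: Hirahara2018, Lemma 4.4] -/
def greedyWord (hb : 0 < b) (prev : List (Fin ℓ → Fin b)) : Fin ℓ → Fin b :=
  fun r => (greedyPrefix hb prev ℓ)[(r : ℕ)]'(by rw [length_greedyPrefix]; exact r.isLt)

/-- **Quality of the greedy word**: `b^ℓ · ∑_{g ∈ prev} 2^{agree w g} ≤ (b+1)^ℓ · |prev|`.
[cite: RazReingoldVadhan2002, Lemma 15] [cite: Hirahara2018, Lemma 4.4] -/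
theorem quality_greedyWord (hb : 0 < b) (prev : List (Fin ℓ → Fin b)) :
    b ^ ℓ * (prev.map fun g => 2 ^ agree (greedyWord hb prev) g).sum ≤ (b + 1) ^ ℓ * prev.length := by
  have h := pow_mul_phi_greedyPrefix_le hb prev (k := ℓ) le_rfl
  rwa [phi_eq_sum_agree prev _ (length_greedyPrefix hb prev ℓ)] at h

/-! ### The weak design -/

/-- **The weak design as a list**: `m` words, the `i`-th greedy against the first `i`.
[cite: Hirahara2018, Lemma 4.4] [cite: RazReingoldVadhan2002, Lemma 15] -/
def wdList (hb : 0 < b) (ℓ : ℕ) : ℕ → List (Fin ℓ → Fin b)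
  | 0 => []
  | i + 1 => wdList hb ℓ i ++ [greedyWord hb (wdList hb ℓ i)]

/-- `wdList m` has `m` words. [folklore] -/
@[simp] theorem length_wdList (hb : 0 < b) (ℓ m : ℕ) : (wdList hb ℓ m).length = m := by
  induction m with
  | zero => rfl
  | succ m ih => simp [wdList, ih]

/-- The lists are nested: `wdList i` is a prefix of `wdList m` for `i ≤ m`. [folklore] -/
theorem wdList_prefix (hb : 0 < b) (ℓ : ℕ) {i m : ℕ} (h : i ≤ m) : wdList hb ℓ i <+: wdList hb ℓ m := by
  induction h with
  | refl => exact List.prefix_refl _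
  | step _ ih => exact ih.trans (List.prefix_append _ _)

/-- The `i`-th word is the greedy word against the first `i` words. [cite: Hirahara2018, Lemma 4.4] -/
theorem getElem_wdList (hb : 0 < b) (ℓ : ℕ) {i m : ℕ} (h : i < m) :
    (wdList hb ℓ m)[i]'(by rw [length_wdList]; exact h) = greedyWord hb (wdList hb ℓ i) := by
  obtain ⟨t, ht⟩ := wdList_prefix hb ℓ (Nat.succ_le_of_lt h)
  have h' : (wdList hb ℓ m)[i]? = some (greedyWord hb (wdList hb ℓ i)) := by
    rw [← ht, List.getElem?_append_left (by rw [length_wdList]; exact Nat.lt_succ_self i), wdList,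
      List.getElem?_append_right (by rw [length_wdList]), length_wdList, Nat.sub_self, List.getElem?_cons_zero]
  exact (List.getElem_eq_iff _).2 h'

/-- The first `i` words of `wdList m` are `wdList i`. [folklore] -/
theorem take_wdList (hb : 0 < b) (ℓ : ℕ) {i m : ℕ} (h : i ≤ m) : (wdList hb ℓ m).take i = wdList hb ℓ i := by
  have hpre := wdList_prefix hb ℓ h
  rw [List.prefix_iff_eq_take] at hpre
  rw [hpre, length_wdList]

/-- **The weak design** `wd : [m] → ([ℓ] → [b])` (blocks `graphBlock (wd i)` in the universe `[ℓ] × [b]`).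
[cite: Hirahara2018, Lemma 4.4] -/
def wd (hb : 0 < b) (ℓ m : ℕ) (i : Fin m) : Fin ℓ → Fin b :=
  (wdList hb ℓ m)[(i : ℕ)]'(by rw [length_wdList]; exact i.isLt)

/-- `wd i` is the greedy word against `wdList i`. [cite: Hirahara2018, Lemma 4.4] -/
theorem wd_eq_greedyWord (hb : 0 < b) (ℓ m : ℕ) (i : Fin m) : wd hb ℓ m i = greedyWord hb (wdList hb ℓ i) :=
  getElem_wdList hb ℓ i.isLt

/-- **Quality of the weak design** (Hirahara 2018, Lemma 4.4 / RRV Lemma 15, in the form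
`(1 + ℓ/d)^ℓ = ((b+1)/b)^ℓ`, `d = ℓ b`), list form: the total table size of word `i` against its `i`
predecessors satisfies `b^ℓ · ∑_{j<i} 2^{agree wᵢ wⱼ} ≤ (b+1)^ℓ · i`. [cite: Hirahara2018, Lemma 4.4]
[cite: RazReingoldVadhan2002, Lemma 15] -/
theorem quality_wdList (hb : 0 < b) (ℓ i : ℕ) :
    b ^ ℓ * ((wdList hb ℓ i).map fun g => 2 ^ agree (greedyWord hb (wdList hb ℓ i)) g).sum ≤ (b + 1) ^ ℓ * i := by
  simpa only [length_wdList] using quality_greedyWord hb (wdList hb ℓ i)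

/-- The same for the design `wd m` and `i < m`: the predecessors of `wd i` are the first `i` words.
[cite: Hirahara2018, Lemma 4.4] -/
theorem quality_wd (hb : 0 < b) (ℓ m : ℕ) (i : Fin m) :
    b ^ ℓ * (((wdList hb ℓ m).take i).map fun g => 2 ^ agree (wd hb ℓ m i) g).sum ≤ (b + 1) ^ ℓ * i := by
  rw [take_wdList hb ℓ i.isLt.le, wd_eq_greedyWord]
  exact quality_wdList hb ℓ i

/-! ### The elementary estimate `(1 + 1/b)^ℓ ≤ 1 + 2ℓ/b` for `2ℓ ≤ b` -/

/-- For `2ℓ ≤ b`: `(b+1)^ℓ · b ≤ b^ℓ · (b + 2ℓ)`, i.e. `(1 + 1/b)^ℓ ≤ 1 + 2ℓ/b` (induction on `ℓ`; the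
discrete form of `exp(ℓ/b) ≤ 1 + 2ℓ/b` for `ℓ/b ≤ 1`, as used in the proof of Cor. 4.12:
"Since `ℓ²/d ≤ 1`, the length of the description is `≤ (1 + 2ℓ²/d)·m + d + O(log n)`").
[cite: Hirahara2018, Cor. 4.12 (proof)] -/
theorem pow_succ_mul_le {ℓ b : ℕ} (h : 2 * ℓ ≤ b) : (b + 1) ^ ℓ * b ≤ b ^ ℓ * (b + 2 * ℓ) := by
  induction ℓ with
  | zero => simp
  | succ ℓ ih =>
    have ih' := ih (by omega)
    have h2 : 2 * ℓ ≤ b := by omega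
    calc (b + 1) ^ (ℓ + 1) * b = (b + 1) * ((b + 1) ^ ℓ * b) := by ring
      _ ≤ (b + 1) * (b ^ ℓ * (b + 2 * ℓ)) := Nat.mul_le_mul_left _ ih'
      _ = b ^ ℓ * (b * b + 2 * ℓ * b + (b + 2 * ℓ)) := by ring
      _ ≤ b ^ ℓ * (b * b + 2 * ℓ * b + 2 * b) := Nat.mul_le_mul_left _ (by nlinarith)
      _ = b ^ (ℓ + 1) * (b + 2 * (ℓ + 1)) := by ring

end WeakDesign

end Literature.Computability.MetaComplexity
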